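import Summits.CriticalPhenomena.PercolationContinuityZ3.Theorems.PercNearOneGluingNoHeavyPcintClosingCountKernel
import Summits.CriticalPhenomena.PercolationContinuityZ3.Theorems.PercNearOneGluingNoHeavyPcintMemoryFourRecursion
import HarnessLib

/-!
# CriticalPhenomena/PercolationContinuityZ3 — Theorems/PercNearOneGluingNoHeavyPcintClosingOctagonsZ3.lean: `2·8·p_8(ℤ³) ≥ 3312` — the octagons of `ℤ³` by 207 kernel-checked witnesses and two symmetry reductions

Lane prim-pcint, STRUCTURE rule (the third-rung density `f_8(ℤ³) = closingCount 3 8/μ_6⁸` of the typed law C4).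
…PcintClosingCountKernel evaluates `closingCount d τ = cntP (mstep τ) (HasAge (τ−1)) ∅ (τ−1)` directly for `τ = 6`, `d ≤ 4`; at
`τ = 8` the `6⁶`-word evaluation exhausts the kernel.  Here: (1) **`cntP_one_succ`** fixes the SECOND letter too (from the
one-letter state `S₁ = {(−e₀⁺, 1)}` the reversal is refused, `e₀⁺` is one branch, and the `2d − 2` perpendicular letters are images
of `e₁⁺` under the symmetries `(swap 1 a.1, signs)` fixing `e₀⁺` and `S₁`; every `d ≥ 2`, `τ`, age); (2) **`elim_cntP_ge_of_witnesses`**: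
a duplicate-free list of accepted words with the final-state property bounds a branch from below; (3) the 92 closing tails after
`e₀⁺e₀⁺` and the 115 after `e₀⁺e₁⁺` (letter lists, `wordOfList`; seat numerics/oct, brute force) are checked by `decide +kernel` (each: 6 automaton steps and
an age test), whence **`closingCount_eight_zd3_ge : 3312 ≤ closingCount 3 8`** (`= 6·(92 + 4·115)`; equality holds — the lists
are complete — but only `≥` is certified, which is the direction upper bounds on `R_8 = Δ_8/f_8` consume, …RungEightZ3).

HONEST FRAMING: kernel-checked witnesses + bookkeeping; nothing here is used by a certified `p_c` cell.  Written by prim-pcint-2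
gen 17 (prover-prim-pcint-2-g17-0), 2026-08-25.
-/

namespace Summit.CriticalPhenomena.PercolationContinuityZ3.Theorems.Pcint

open Literature.Probability.Percolation Literature.Probability.LatticeModels

variable {d : ℕ}

/-- `cntP` at a successor length with `Option.elim` branches. [folklore] -/
theorem cntP_succ_elim {σ α : Type*} [Fintype α] (step : σ → α → Option σ) (P : σ → Prop) [DecidablePred P] (S : σ) (n : ℕ) :
    cntP step P S (n + 1) = ∑ a, (step S a).elim 0 fun T => cntP step P T n := by
  simp only [cntP]
  refine Finset.sum_congr rfl fun a _ => ?_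
  cases step S a <;> rfl

/-- **Second-letter reduction** (`d ≥ 2`): from the one-letter state `S₁ = {(−e₀⁺, 1)}`, the `2d − 2` perpendicular letters
contribute equally (symmetries `(swap 1 a.1, signs)` fix `e₀⁺` and `S₁` and map `e₁⁺` to `a`), so
`cntP S₁ (n+1) = br(e₀⁺) + br(e₀⁻) + (2d−2)·br(e₁⁺)` with `br(a) = (mstep τ S₁ a).elim 0 (cntP · n)`. [folklore] -/
theorem cntP_one_succ [NeZero d] (hd : 2 ≤ d) (τ j n : ℕ) :
    cntP (mstep τ) (HasAge j) ({(-stepVec ((0 : Fin d), true), 1)} : MState d) (n + 1) =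
      (mstep τ ({(-stepVec ((0 : Fin d), true), 1)} : MState d) ((0 : Fin d), true)).elim 0
          (fun T => cntP (mstep τ) (HasAge j) T n) +
      (mstep τ ({(-stepVec ((0 : Fin d), true), 1)} : MState d) ((0 : Fin d), false)).elim 0
          (fun T => cntP (mstep τ) (HasAge j) T n) +
      (2 * d - 2) * (mstep τ ({(-stepVec ((0 : Fin d), true), 1)} : MState d) ((⟨1, hd⟩ : Fin d), true)).elim 0
          (fun T => cntP (mstep τ) (HasAge j) T n) := by
  set e₀ : Fin d × Bool := ((0 : Fin d), true) with he₀
  set e₁ : Fin d × Bool := ((⟨1, hd⟩ : Fin d), true) with he₁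
  set S₁ : MState d := {(-stepVec e₀, 1)} with hS₁
  set F : MState d → ℕ := fun T => cntP (mstep τ) (HasAge j) T n with hF
  have h01 : (0 : Fin d) ≠ ⟨1, hd⟩ := fun h => absurd (congrArg Fin.val h) (by simp)
  -- the perpendicular branches are all equal to the `e₁` branch
  have hperp : ∀ a : Fin d × Bool, a.1 ≠ 0 → (mstep τ S₁ a).elim 0 F = (mstep τ S₁ e₁).elim 0 F := by
    intro a ha
    set g : SPerm d := (Equiv.swap (⟨1, hd⟩ : Fin d) a.1, fun i => if i = 0 then true else a.2) with hg
    have hg1 : smulLetter g e₁ = a := by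
      rcases a with ⟨i, b⟩
      simp only [smulLetter, hg, he₁, Equiv.symm_swap, Equiv.swap_apply_left]
      simp only at ha
      rw [if_neg ha]
      cases b <;> rfl
    have hg0 : smulLetter g e₀ = e₀ := by
      simp only [smulLetter, hg, he₀, Equiv.symm_swap]
      rw [Equiv.swap_apply_of_ne_of_ne h01 (Ne.symm ha)]
      simp
    have hgS : smulState g S₁ = S₁ := by
      rw [hS₁, smulState, Finset.image_singleton, smulSite_neg, ← stepVec_smulLetter, hg0]
    have hm : mstep τ S₁ a = (mstep τ S₁ e₁).map (smulState g) := by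
      rw [← hg1, ← mstep_smul, hgS]
    rw [hm]
    cases mstep τ S₁ e₁ with
    | none => rfl
    | some T => simp only [Option.map_some, Option.elim_some, hF, cntP_hasAge_smulState]
  rw [cntP_succ_elim, ← Finset.sum_filter_add_sum_filter_not Finset.univ (fun a : Fin d × Bool => a.1 = 0)]
  -- the two letters on axis 0
  have hax : (Finset.univ.filter fun a : Fin d × Bool => a.1 = 0) = {((0 : Fin d), true), ((0 : Fin d), false)} := by
    ext ⟨i, b⟩
    simp only [Finset.mem_filter, Finset.mem_univ, true_and, Finset.mem_insert, Finset.mem_singleton, Prod.mk.injEq]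
    cases b <;> simp
  rw [hax, Finset.sum_pair (by simp)]
  -- the perpendicular letters
  have hc := MemoryTail.card_filter_fst_ne' (d := d) (0 : Fin d)
  simp only [ne_eq] at hc
  rw [Finset.sum_congr rfl fun a ha => hperp a (by rw [Finset.mem_filter] at ha; exact ha.2), Finset.sum_const, hc,
    smul_eq_mul]


/-- A letter list read as a word of length `n` (padding with `e₀⁺`). [folklore] -/
def wordOfList [NeZero d] (n : ℕ) (l : List (Fin d × Bool)) : Fin n → Fin d × Bool := fun i => l.getD i.1 ((0 : Fin d), true)

/-- `wordOfList n` is injective on lists of length `n`. [folklore] -/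
theorem wordOfList_injOn [NeZero d] (n : ℕ) {l l' : List (Fin d × Bool)} (hl : l.length = n) (hl' : l'.length = n)
    (h : wordOfList n l = wordOfList n l') : l = l' := by
  apply List.ext_getElem (by rw [hl, hl'])
  intro i hi hi'
  have := congrFun h ⟨i, by omega⟩
  simp only [wordOfList] at this
  rw [List.getD_eq_getElem l _ hi, List.getD_eq_getElem l' _ hi'] at this
  exact this

/-- **Witness bound**: a duplicate-free list of letter lists of length `n`, each accepted (with the final-state property) from
the `a`-successor of `S`, bounds the `a`-branch of `cntP S (n+1)` from below. [folklore] -/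
theorem elim_cntP_ge_of_witnesses [NeZero d] {σ : Type*} (step : σ → (Fin d × Bool) → Option σ) (P : σ → Prop)
    [DecidablePred P] (S : σ) (a : Fin d × Bool) (n : ℕ) (L : List (List (Fin d × Bool))) (hnd : L.Nodup)
    (hlen : ∀ l ∈ L, l.length = n)
    (hacc : ∀ l ∈ L, AccP P ((step S a).bind fun T => runW step n T (wordOfList n l))) :
    L.length ≤ (step S a).elim 0 fun T => cntP step P T n := by
  classical
  have hinj : Set.InjOn (wordOfList (d := d) n) {l | l ∈ L} := fun l hl l' hl' h =>
    wordOfList_injOn n (hlen l hl) (hlen l' hl') h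
  have hnd' : (L.map (wordOfList (d := d) n)).Nodup := hnd.map_on fun l hl l' hl' h => hinj hl hl' h
  cases hS : step S a with
  | none =>
    cases L with
    | nil => simp
    | cons u L' =>
      have := hacc u (by simp)
      rw [hS, Option.bind_none] at this
      obtain ⟨T, hT, -⟩ := this
      exact absurd hT (by simp)
  | some T =>
    simp only [Option.elim_some]
    rw [← card_acceptedP_eq_cntP, Fintype.card_subtype, ← List.length_map (f := wordOfList (d := d) n),
      ← List.toFinset_card_of_nodup hnd']
    refine Finset.card_le_card ?_
    intro u hu
    rw [Finset.mem_filter]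
    refine ⟨Finset.mem_univ _, ?_⟩
    obtain ⟨l, hl, rfl⟩ := List.mem_map.1 (List.mem_toFinset.1 hu)
    have := hacc l hl
    rwa [hS, Option.bind_some] at this

/-- The 92 closing tails after `e₀⁺ e₀⁺` on `ℤ³` (memory 8), as letter lists. [this work] -/
def octTailsStraight : List (List (Fin 3 × Bool)) := [
  [(0, true), (1, true), (0, false), (0, false), (0, false)], [(0, true), (1, false), (0, false), (0, false), (0, false)], [(0, true), (2, true), (0, false), (0, false), (0, false)],
  [(0, true), (2, false), (0, false), (0, false), (0, false)], [(1, true), (0, false), (0, false), (0, false), (1, false)], [(1, true), (0, false), (0, false), (2, true), (1, false)],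
  [(1, true), (0, false), (0, false), (2, false), (1, false)], [(1, true), (0, false), (1, true), (0, false), (1, false)], [(1, true), (0, false), (2, true), (0, false), (1, false)],
  [(1, true), (0, false), (2, true), (0, false), (2, false)], [(1, true), (0, false), (2, true), (1, false), (0, false)], [(1, true), (0, false), (2, false), (0, false), (1, false)],
  [(1, true), (0, false), (2, false), (0, false), (2, true)], [(1, true), (0, false), (2, false), (1, false), (0, false)], [(1, true), (1, true), (0, false), (0, false), (1, false)],
  [(1, true), (1, true), (0, false), (1, false), (0, false)], [(1, true), (2, true), (0, false), (0, false), (1, false)], [(1, true), (2, true), (0, false), (0, false), (2, false)],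
  [(1, true), (2, true), (0, false), (1, false), (0, false)], [(1, true), (2, true), (0, false), (2, false), (0, false)], [(1, true), (2, true), (1, false), (0, false), (0, false)],
  [(1, true), (2, false), (0, false), (0, false), (1, false)], [(1, true), (2, false), (0, false), (0, false), (2, true)], [(1, true), (2, false), (0, false), (1, false), (0, false)],
  [(1, true), (2, false), (0, false), (2, true), (0, false)], [(1, true), (2, false), (1, false), (0, false), (0, false)], [(1, false), (0, false), (0, false), (0, false), (1, true)],
  [(1, false), (0, false), (0, false), (2, true), (1, true)], [(1, false), (0, false), (0, false), (2, false), (1, true)], [(1, false), (0, false), (1, false), (0, false), (1, true)],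
  [(1, false), (0, false), (2, true), (0, false), (1, true)], [(1, false), (0, false), (2, true), (0, false), (2, false)], [(1, false), (0, false), (2, true), (1, true), (0, false)],
  [(1, false), (0, false), (2, false), (0, false), (1, true)], [(1, false), (0, false), (2, false), (0, false), (2, true)], [(1, false), (0, false), (2, false), (1, true), (0, false)],
  [(1, false), (1, false), (0, false), (0, false), (1, true)], [(1, false), (1, false), (0, false), (1, true), (0, false)], [(1, false), (2, true), (0, false), (0, false), (1, true)],
  [(1, false), (2, true), (0, false), (0, false), (2, false)], [(1, false), (2, true), (0, false), (1, true), (0, false)], [(1, false), (2, true), (0, false), (2, false), (0, false)],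
  [(1, false), (2, true), (1, true), (0, false), (0, false)], [(1, false), (2, false), (0, false), (0, false), (1, true)], [(1, false), (2, false), (0, false), (0, false), (2, true)],
  [(1, false), (2, false), (0, false), (1, true), (0, false)], [(1, false), (2, false), (0, false), (2, true), (0, false)], [(1, false), (2, false), (1, true), (0, false), (0, false)],
  [(2, true), (0, false), (0, false), (0, false), (2, false)], [(2, true), (0, false), (0, false), (1, true), (2, false)], [(2, true), (0, false), (0, false), (1, false), (2, false)],
  [(2, true), (0, false), (1, true), (0, false), (1, false)], [(2, true), (0, false), (1, true), (0, false), (2, false)], [(2, true), (0, false), (1, true), (2, false), (0, false)],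
  [(2, true), (0, false), (1, false), (0, false), (1, true)], [(2, true), (0, false), (1, false), (0, false), (2, false)], [(2, true), (0, false), (1, false), (2, false), (0, false)],
  [(2, true), (0, false), (2, true), (0, false), (2, false)], [(2, true), (1, true), (0, false), (0, false), (1, false)], [(2, true), (1, true), (0, false), (0, false), (2, false)],
  [(2, true), (1, true), (0, false), (1, false), (0, false)], [(2, true), (1, true), (0, false), (2, false), (0, false)], [(2, true), (1, true), (2, false), (0, false), (0, false)],
  [(2, true), (1, false), (0, false), (0, false), (1, true)], [(2, true), (1, false), (0, false), (0, false), (2, false)], [(2, true), (1, false), (0, false), (1, true), (0, false)],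
  [(2, true), (1, false), (0, false), (2, false), (0, false)], [(2, true), (1, false), (2, false), (0, false), (0, false)], [(2, true), (2, true), (0, false), (0, false), (2, false)],
  [(2, true), (2, true), (0, false), (2, false), (0, false)], [(2, false), (0, false), (0, false), (0, false), (2, true)], [(2, false), (0, false), (0, false), (1, true), (2, true)],
  [(2, false), (0, false), (0, false), (1, false), (2, true)], [(2, false), (0, false), (1, true), (0, false), (1, false)], [(2, false), (0, false), (1, true), (0, false), (2, true)],
  [(2, false), (0, false), (1, true), (2, true), (0, false)], [(2, false), (0, false), (1, false), (0, false), (1, true)], [(2, false), (0, false), (1, false), (0, false), (2, true)],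
  [(2, false), (0, false), (1, false), (2, true), (0, false)], [(2, false), (0, false), (2, false), (0, false), (2, true)], [(2, false), (1, true), (0, false), (0, false), (1, false)],
  [(2, false), (1, true), (0, false), (0, false), (2, true)], [(2, false), (1, true), (0, false), (1, false), (0, false)], [(2, false), (1, true), (0, false), (2, true), (0, false)],
  [(2, false), (1, true), (2, true), (0, false), (0, false)], [(2, false), (1, false), (0, false), (0, false), (1, true)], [(2, false), (1, false), (0, false), (0, false), (2, true)],
  [(2, false), (1, false), (0, false), (1, true), (0, false)], [(2, false), (1, false), (0, false), (2, true), (0, false)], [(2, false), (1, false), (2, true), (0, false), (0, false)],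
  [(2, false), (2, false), (0, false), (0, false), (2, true)], [(2, false), (2, false), (0, false), (2, true), (0, false)]
]

/-- The 115 closing tails after `e₀⁺ e₁⁺` on `ℤ³` (memory 8), as letter lists. [this work] -/
def octTailsPerp : List (List (Fin 3 × Bool)) := [
  [(0, true), (1, true), (0, false), (0, false), (1, false)], [(0, true), (1, false), (1, false), (0, false), (0, false)], [(0, true), (1, false), (2, true), (0, false), (0, false)],
  [(0, true), (1, false), (2, false), (0, false), (0, false)], [(0, true), (2, true), (0, false), (0, false), (1, false)], [(0, true), (2, true), (0, false), (0, false), (2, false)],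
  [(0, true), (2, true), (0, false), (1, false), (0, false)], [(0, true), (2, true), (1, false), (0, false), (0, false)], [(0, true), (2, false), (0, false), (0, false), (1, false)],
  [(0, true), (2, false), (0, false), (0, false), (2, true)], [(0, true), (2, false), (0, false), (1, false), (0, false)], [(0, true), (2, false), (1, false), (0, false), (0, false)],
  [(0, false), (0, false), (0, false), (1, false), (0, true)], [(0, false), (0, false), (1, false), (1, false), (0, true)], [(0, false), (0, false), (1, false), (2, true), (0, true)],
  [(0, false), (0, false), (1, false), (2, false), (0, true)], [(0, false), (0, false), (2, true), (0, true), (1, false)], [(0, false), (0, false), (2, true), (1, false), (0, true)],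
  [(0, false), (0, false), (2, true), (1, false), (2, false)], [(0, false), (0, false), (2, false), (0, true), (1, false)], [(0, false), (0, false), (2, false), (1, false), (0, true)],
  [(0, false), (0, false), (2, false), (1, false), (2, true)], [(0, false), (1, true), (0, false), (1, false), (1, false)], [(0, false), (1, true), (2, true), (1, false), (1, false)],
  [(0, false), (1, true), (2, false), (1, false), (1, false)], [(0, false), (2, true), (0, true), (1, false), (0, false)], [(0, false), (2, true), (0, false), (1, false), (0, true)],
  [(0, false), (2, true), (0, false), (1, false), (2, false)], [(0, false), (2, true), (0, false), (2, false), (1, false)], [(0, false), (2, true), (1, false), (0, false), (2, false)],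
  [(0, false), (2, true), (1, false), (1, false), (2, false)], [(0, false), (2, true), (2, true), (1, false), (2, false)], [(0, false), (2, false), (0, true), (1, false), (0, false)],
  [(0, false), (2, false), (0, false), (1, false), (0, true)], [(0, false), (2, false), (0, false), (1, false), (2, true)], [(0, false), (2, false), (0, false), (2, true), (1, false)],
  [(0, false), (2, false), (1, false), (0, false), (2, true)], [(0, false), (2, false), (1, false), (1, false), (2, true)], [(0, false), (2, false), (2, false), (1, false), (2, true)],
  [(1, true), (0, false), (0, false), (1, false), (0, true)], [(1, true), (0, false), (0, false), (1, false), (1, false)], [(1, true), (0, false), (1, false), (0, false), (1, false)],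
  [(1, true), (0, false), (1, false), (2, true), (1, false)], [(1, true), (0, false), (1, false), (2, false), (1, false)], [(1, true), (0, false), (2, true), (1, false), (1, false)],
  [(1, true), (0, false), (2, true), (1, false), (2, false)], [(1, true), (0, false), (2, false), (1, false), (1, false)], [(1, true), (0, false), (2, false), (1, false), (2, true)],
  [(1, true), (1, true), (0, false), (1, false), (1, false)], [(1, true), (2, true), (0, false), (1, false), (1, false)], [(1, true), (2, true), (0, false), (1, false), (2, false)],
  [(1, true), (2, true), (0, false), (2, false), (1, false)], [(1, true), (2, true), (1, false), (0, false), (1, false)], [(1, true), (2, true), (1, false), (0, false), (2, false)],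
  [(1, true), (2, true), (1, false), (1, false), (0, false)], [(1, true), (2, false), (0, false), (1, false), (1, false)], [(1, true), (2, false), (0, false), (1, false), (2, true)],
  [(1, true), (2, false), (0, false), (2, true), (1, false)], [(1, true), (2, false), (1, false), (0, false), (1, false)], [(1, true), (2, false), (1, false), (0, false), (2, true)],
  [(1, true), (2, false), (1, false), (1, false), (0, false)], [(2, true), (0, true), (1, false), (0, false), (0, false)], [(2, true), (0, false), (0, false), (1, false), (0, true)],
  [(2, true), (0, false), (0, false), (1, false), (2, false)], [(2, true), (0, false), (0, false), (2, false), (0, true)], [(2, true), (0, false), (0, false), (2, false), (1, false)],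
  [(2, true), (0, false), (1, true), (2, false), (1, false)], [(2, true), (0, false), (1, false), (0, false), (2, false)], [(2, true), (0, false), (1, false), (1, false), (2, false)],
  [(2, true), (0, false), (2, true), (1, false), (2, false)], [(2, true), (0, false), (2, false), (0, false), (1, false)], [(2, true), (0, false), (2, false), (2, false), (1, false)],
  [(2, true), (1, true), (0, false), (1, false), (1, false)], [(2, true), (1, true), (0, false), (1, false), (2, false)], [(2, true), (1, true), (0, false), (2, false), (1, false)],
  [(2, true), (1, true), (2, false), (0, false), (1, false)], [(2, true), (1, false), (0, false), (0, false), (2, false)], [(2, true), (1, false), (0, false), (1, true), (2, false)],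
  [(2, true), (1, false), (0, false), (1, false), (2, false)], [(2, true), (1, false), (1, false), (0, false), (1, true)], [(2, true), (1, false), (1, false), (0, false), (2, false)],
  [(2, true), (1, false), (1, false), (2, false), (0, false)], [(2, true), (1, false), (2, true), (0, false), (2, false)], [(2, true), (2, true), (0, false), (1, false), (2, false)],
  [(2, true), (2, true), (0, false), (2, false), (1, false)], [(2, true), (2, true), (0, false), (2, false), (2, false)], [(2, true), (2, true), (1, false), (0, false), (2, false)],
  [(2, true), (2, true), (1, false), (2, false), (0, false)], [(2, false), (0, true), (1, false), (0, false), (0, false)], [(2, false), (0, false), (0, false), (1, false), (0, true)],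
  [(2, false), (0, false), (0, false), (1, false), (2, true)], [(2, false), (0, false), (0, false), (2, true), (0, true)], [(2, false), (0, false), (0, false), (2, true), (1, false)],
  [(2, false), (0, false), (1, true), (2, true), (1, false)], [(2, false), (0, false), (1, false), (0, false), (2, true)], [(2, false), (0, false), (1, false), (1, false), (2, true)],
  [(2, false), (0, false), (2, true), (0, false), (1, false)], [(2, false), (0, false), (2, true), (2, true), (1, false)], [(2, false), (0, false), (2, false), (1, false), (2, true)],
  [(2, false), (1, true), (0, false), (1, false), (1, false)], [(2, false), (1, true), (0, false), (1, false), (2, true)], [(2, false), (1, true), (0, false), (2, true), (1, false)],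
  [(2, false), (1, true), (2, true), (0, false), (1, false)], [(2, false), (1, false), (0, false), (0, false), (2, true)], [(2, false), (1, false), (0, false), (1, true), (2, true)],
  [(2, false), (1, false), (0, false), (1, false), (2, true)], [(2, false), (1, false), (1, false), (0, false), (1, true)], [(2, false), (1, false), (1, false), (0, false), (2, true)],
  [(2, false), (1, false), (1, false), (2, true), (0, false)], [(2, false), (1, false), (2, false), (0, false), (2, true)], [(2, false), (2, false), (0, false), (1, false), (2, true)],
  [(2, false), (2, false), (0, false), (2, true), (1, false)], [(2, false), (2, false), (0, false), (2, true), (2, true)], [(2, false), (2, false), (1, false), (0, false), (2, true)],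
  [(2, false), (2, false), (1, false), (2, true), (0, false)]
]

/-- The straight witnesses are duplicate-free. [this work] -/
theorem octTailsStraight_nodup : octTailsStraight.Nodup := by decide +kernel

/-- The straight witnesses have length 5. [this work] -/
theorem octTailsStraight_length : ∀ l ∈ octTailsStraight, l.length = 5 := by decide +kernel

/-- The straight witnesses are accepted with the start still remembered (92 runs of the memory-8 automaton). [this work] -/
theorem octTailsStraight_acc : ∀ l ∈ octTailsStraight, AccP (HasAge 7)
    ((mstep 8 ({(-stepVec ((0 : Fin 3), true), 1)} : MState 3) ((0 : Fin 3), true)).bind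
      fun T => runW (mstep 8) 5 T (wordOfList 5 l)) := by
  decide +kernel

/-- The perpendicular witnesses are duplicate-free. [this work] -/
theorem octTailsPerp_nodup : octTailsPerp.Nodup := by decide +kernel

/-- The perpendicular witnesses have length 5. [this work] -/
theorem octTailsPerp_length : ∀ l ∈ octTailsPerp, l.length = 5 := by decide +kernel

/-- The perpendicular witnesses are accepted with the start still remembered (115 runs). [this work] -/
theorem octTailsPerp_acc : ∀ l ∈ octTailsPerp, AccP (HasAge 7)
    ((mstep 8 ({(-stepVec ((0 : Fin 3), true), 1)} : MState 3) ((⟨1, by norm_num⟩ : Fin 3), true)).bind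
      fun T => runW (mstep 8) 5 T (wordOfList 5 l)) := by
  decide +kernel

/-- The straight branch is at least 92. [this work] -/
theorem oct_branch_straight_ge :
    92 ≤ (mstep 8 ({(-stepVec ((0 : Fin 3), true), 1)} : MState 3) ((0 : Fin 3), true)).elim 0
      fun T => cntP (mstep 8) (HasAge 7) T 5 := by
  have h := elim_cntP_ge_of_witnesses (mstep 8) (HasAge 7) ({(-stepVec ((0 : Fin 3), true), 1)} : MState 3)
    ((0 : Fin 3), true) 5 octTailsStraight octTailsStraight_nodup octTailsStraight_length octTailsStraight_acc
  have hl : octTailsStraight.length = 92 := rfl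
  rwa [hl] at h

/-- The perpendicular branch is at least 115. [this work] -/
theorem oct_branch_perp_ge :
    115 ≤ (mstep 8 ({(-stepVec ((0 : Fin 3), true), 1)} : MState 3) ((⟨1, by norm_num⟩ : Fin 3), true)).elim 0
      fun T => cntP (mstep 8) (HasAge 7) T 5 := by
  have h := elim_cntP_ge_of_witnesses (mstep 8) (HasAge 7) ({(-stepVec ((0 : Fin 3), true), 1)} : MState 3)
    ((⟨1, by norm_num⟩ : Fin 3), true) 5 octTailsPerp octTailsPerp_nodup octTailsPerp_length octTailsPerp_acc
  have hl : octTailsPerp.length = 115 := rfl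
  rwa [hl] at h

/-- Arithmetic of the assembly (atoms kept abstract so that the kernel never unfolds a branch). [folklore] -/
theorem oct_assembly {x A B C : ℕ} (hx : x = 2 * 3 * (A + B + (2 * 3 - 2) * C)) (hA : 92 ≤ A) (hC : 115 ≤ C) :
    3312 ≤ x := by
  omega

/-- **`2·8·p_8(ℤ³) ≥ 3312`** (`p_8(ℤ³) ≥ 207`; in fact `= 207`). [this work] -/
theorem closingCount_eight_zd3_ge : 3312 ≤ MemoryTail.closingCount 3 8 := by
  have e := closingCount_eq_cntP (τ := 8) (by norm_num) 3
  rw [show (8 : ℕ) - 1 = 7 from rfl] at e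
  have e0 := cntP_empty_succ (d := 3) 8 7 6
  rw [show (6 : ℕ) + 1 = 7 from rfl] at e0
  rw [e0] at e
  have e1 := cntP_one_succ (d := 3) (by norm_num) 8 7 5
  rw [show (5 : ℕ) + 1 = 6 from rfl] at e1
  rw [e1] at e
  exact oct_assembly e oct_branch_straight_ge oct_branch_perp_ge

end Summit.CriticalPhenomena.PercolationContinuityZ3.Theorems.Pcint
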